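import Summits.Schanuel.Schanuel.Theses.RoyCriterion
import Summits.Schanuel.Schanuel.Theorems.RoySmallValueDirichletGap.Negative.TauLtOneAndCountLeDegreeFalse

/-!
# `RoyThesis`: load-bearing hypotheses and tightness (negative lemmas for crux `stmt-Schanuel-0078`)

Load-bearing analysis of the crux `Summit.Schanuel.Schanuel.Theses.RoyCriterion.RoyThesis`
(`= ∀ n, RoyCriterion n`, Roy 2001, Acta Arith. 97, Conjecture 2 for every rank; rfl-twin of
`RoyThesisTyped`). Each hypothesis of `RoyCriterion` is deleted in turn and the resulting statement is
refuted by an explicit kernel-checked witness; the conclusion exponent is shown sharp: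

* `royThesis_false_without_linearIndependent` (`y = 0`, `α = e^0 = 1`, hypothesis by the in-tree
  Thue–Siegel auxiliary polynomial `royHypothesis_exp'`; indeed the deleted-hypothesis statement fails
  at EVERY rank `n ≥ 1` and EVERY admissible tuple, `royThesis_withoutLinearIndependent_fails`);
* `royThesis_false_without_units` (`(y, α) = (1, 0)`, `P_N = X₁ · R_N` with `R_N` from
  `exists_royAuxPoly`: the translate `m = 0` is `(0, 1) = (0, e^0)`, the others are `(m, 0)` where
  `X₁ ∣ D^k(X₁ R_N)`; `royHypothesis_one_zero`);
* `royThesis_false_without_window1`: the inequality `max(1, t₀, 2t₁) < min(s₀, 2s₁)` of Roy's window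
  (1) deleted, positivity and both `u`-inequalities kept (`(1, 1)`, `(s₀,s₁,t₀,t₁,u) = (1/2,1,10,1,3)`,
  `P_N = (X₁ − 1)^{⌊√N⌋+1}` with exact zeros, `royHypothesis_one_one`); a fortiori
  `royThesis_false_without_admissible`;
* `royThesis_conclusion_sharp`: the conclusion `trdeg ≥ n` cannot be improved to `≥ n + 1`
  (`(1, e)`, `trdeg ℚ(e) ≤ 1`).

Everything is proved; no definitions, no named facts. Companion: the crux workfile
`Cruxes/RoyThesis/Disproof.lean` (which also records that `RoyThesis ↔ Schanuel` is a theorem in tree,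
so that no refutation of the crux itself is to be expected).
-/

noncomputable section

namespace Summit.Schanuel.Schanuel.Theorems.RoyThesisNegative

open MvPolynomial Filter Complex Metric
open Literature.NumberTheory.Transcendental
open Summit.Schanuel.Schanuel.Theorems.RoySmallValueDirichletGapTauCount
  (aeval_iterate_royD_pow_eq_zero X_one_sub_one_ne_zero totalDegree_pow_X_one_sub_one_le
    mvPolyHeight_pow_X_one_sub_one_le eventually_nat_mul_rpow_le_rpow)

/-! ### Toolbox -/

/-- An adjunction of algebraic numbers has transcendence degree `0`. [folklore] -/
theorem trdeg_adjoin_eq_zero {S : Set ℂ} (hS : ∀ x ∈ S, IsIntegral ℚ x) :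
    Algebra.trdeg ℚ ↥(IntermediateField.adjoin ℚ S) = 0 := by
  rw [trdeg_eq_zero_iff]
  exact IntermediateField.isAlgebraic_adjoin hS

open scoped IntermediateField.algebraAdjoinAdjoin in
/-- `trdeg_ℚ ℚ(t) ≤ 1`. [folklore] -/
theorem trdeg_adjoin_simple_le_one (t : ℂ) :
    Algebra.trdeg ℚ ↥(IntermediateField.adjoin ℚ ({t} : Set ℂ)) ≤ 1 := by
  classical
  let Lt : IntermediateField ℚ ℂ := IntermediateField.adjoin ℚ ({t} : Set ℂ)
  let t' : Lt := ⟨t, IntermediateField.mem_adjoin_simple_self ℚ t⟩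
  have hmap : Subalgebra.map Lt.val (Algebra.adjoin ℚ ({t'} : Set Lt)) =
      Algebra.adjoin ℚ ({t} : Set ℂ) := by
    rw [AlgHom.map_adjoin, Set.image_singleton]
    rfl
  let e : Algebra.adjoin ℚ ({t'} : Set Lt) ≃ₐ[ℚ] Algebra.adjoin ℚ ({t} : Set ℂ) :=
    (Subalgebra.equivMapOfInjective _ Lt.val Subtype.val_injective).trans
      (Subalgebra.equivOfEq _ _ hmap)
  haveI : Algebra.IsAlgebraic (Algebra.adjoin ℚ ({t'} : Set Lt)) Lt := by
    refine ⟨fun y => ?_⟩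
    have hy : IsAlgebraic (Algebra.adjoin ℚ ({t} : Set ℂ)) (y : Lt) :=
      Algebra.IsAlgebraic.isAlgebraic y
    refine IsAlgebraic.of_ringHom_of_comp_eq (e : _ →+* _) (RingHom.id Lt) (by simpa using hy)
      e.surjective Function.injective_id ?_
    ext x
    rfl
  have h := Algebra.IsAlgebraic.trdeg_le_cardinalMk (R := ℚ) ({t'} : Set Lt)
  simpa using h

/-- `trdeg_ℚ ℚ(S) ≤ 1` when `S ⊆ ℚ(t)`. [folklore] -/
theorem trdeg_adjoin_le_one_of_subset {S : Set ℂ} (t : ℂ)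
    (hS : S ⊆ IntermediateField.adjoin ℚ ({t} : Set ℂ)) :
    Algebra.trdeg ℚ ↥(IntermediateField.adjoin ℚ S) ≤ 1 := by
  have hle : IntermediateField.adjoin ℚ S ≤ IntermediateField.adjoin ℚ ({t} : Set ℂ) :=
    IntermediateField.adjoin_le_iff.mpr hS
  exact (trdeg_le_of_injective (IntermediateField.inclusion hle)
    (IntermediateField.inclusion_injective hle)).trans (trdeg_adjoin_simple_le_one t)

/-- `(1)` is a `ℚ`-linearly independent family of rank one. [folklore] -/
theorem linearIndependent_one : LinearIndependent ℚ (![1] : Fin 1 → ℂ) :=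
  linearIndependent_unique_iff.2 (by simp)

/-- The rank-one conclusion fails at `(1, c)` for algebraic `c`: `trdeg ℚ(1, c) = 0`. [folklore] -/
theorem not_one_le_trdeg_one {c : ℂ} (hc : IsIntegral ℚ c) :
    ¬ ((1 : ℕ) : Cardinal) ≤ Algebra.trdeg ℚ ↥(IntermediateField.adjoin ℚ
      (Set.range (![1] : Fin 1 → ℂ) ∪ Set.range (![c] : Fin 1 → ℂ))) := by
  rw [trdeg_adjoin_eq_zero]
  · simp
  · rintro x (⟨j, rfl⟩ | ⟨j, rfl⟩)
    · have : (![(1 : ℂ)] j) = 1 := by fin_cases j; rfl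
      rw [this]; exact isIntegral_one
    · have : (![c] j) = c := by fin_cases j; rfl
      rw [this]; exact hc

/-- The evaluation point of Roy's hypothesis for the rank-one datum `(1, α)` is `(m, α^m)`. [folklore] -/
theorem point_one (α : ℂ) (m : Fin 1 → ℕ) :
    (![∑ j, (m j : ℂ) * (![(1 : ℂ)] : Fin 1 → ℂ) j, ∏ j, (![α] : Fin 1 → ℂ) j ^ m j] : Fin 2 → ℂ) =
      ![(m 0 : ℂ), α ^ m 0] := by
  simp

/-- `D^k (X₁ R) ∈ X₁ ℤ[X₀, X₁]` (because `D X₁ = X₁`). [cite: Roy2001, §1 (D X₁ = X₁)] -/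
theorem exists_iterate_royD_X_one_mul (k : ℕ) (R : MvPolynomial (Fin 2) ℤ) :
    ∃ Q : MvPolynomial (Fin 2) ℤ, royD^[k] (X 1 * R) = X 1 * Q := by
  induction k with
  | zero => exact ⟨R, rfl⟩
  | succ k ih =>
    obtain ⟨Q, hQ⟩ := ih
    refine ⟨Q + royD Q, ?_⟩
    rw [Function.iterate_succ_apply', hQ, royD_mul, royD_X_one]
    ring

/-- Multiplying by a variable does not raise the height. [folklore] -/
theorem mvPolyHeight_X_mul_le (i : Fin 2) (R : MvPolynomial (Fin 2) ℤ) :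
    mvPolyHeight (X i * R) ≤ mvPolyHeight R := by
  classical
  refine Finset.sup_le fun m _ => ?_
  rw [coeff_X_mul']
  split_ifs
  · exact natAbs_coeff_le_mvPolyHeight _ _
  · simp

/-- `deg_{X_i}(X_j R) ≤ [i = j] + deg_{X_i} R`. [folklore] -/
theorem degreeOf_X_mul_le (i j : Fin 2) (R : MvPolynomial (Fin 2) ℤ) :
    (X j * R).degreeOf i ≤ (if i = j then 1 else 0) + R.degreeOf i := by
  classical
  exact (degreeOf_mul_le _ _ _).trans (by rw [degreeOf_X])

/-! ### `LinearIndependent ℚ y` is load-bearing -/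

/-- **Without linear independence the criterion fails at EVERY rank `n ≥ 1` and EVERY admissible
tuple**: `y = 0`, `α = e^0 = 1`; the hypothesis holds by the in-tree auxiliary polynomial
`royHypothesis_exp'` (Thue–Siegel + Schwarz), and `trdeg ℚ(0, 1) = 0`.
[cite: Roy2001, Conjecture 2 (hypothesis "linearly independent over ℚ")] -/
theorem royThesis_withoutLinearIndependent_fails {n : ℕ} (hn : 1 ≤ n) {s₀ s₁ t₀ t₁ u : ℝ}
    (hadm : RoyAdmissible s₀ s₁ t₀ t₁ u) :
    ∃ y α : Fin n → ℂ, (∀ j, α j ≠ 0) ∧ RoyHypothesis y α s₀ s₁ t₀ t₁ u ∧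
      ¬ (n : Cardinal) ≤ Algebra.trdeg ℚ ↥(IntermediateField.adjoin ℚ (Set.range y ∪ Set.range α)) := by
  refine ⟨0, cexp ∘ 0, fun j => Complex.exp_ne_zero _, royHypothesis_exp' 0 hadm, ?_⟩
  rw [trdeg_adjoin_eq_zero]
  · have : (1 : Cardinal) ≤ n := by exact_mod_cast hn
    intro h
    exact (lt_of_lt_of_le zero_lt_one (this.trans h)).ne rfl
  · haveI : NeZero n := ⟨by omega⟩
    rintro x (⟨j, rfl⟩ | ⟨j, rfl⟩)
    · simpa using isIntegral_zero
    · simpa using isIntegral_one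

/-- **`LinearIndependent ℚ y` is load-bearing in `RoyThesis`**: the crux with that hypothesis
deleted (verbatim otherwise) is FALSE. [cite: Roy2001, Conjecture 2] -/
theorem royThesis_false_without_linearIndependent :
    ¬ (∀ (n : ℕ) (y α : Fin n → ℂ), (∀ j, α j ≠ 0) →
      ∀ (s₀ s₁ t₀ t₁ u : ℝ), RoyAdmissible s₀ s₁ t₀ t₁ u → RoyHypothesis y α s₀ s₁ t₀ t₁ u →
        (n : Cardinal) ≤ Algebra.trdeg ℚ ↥(IntermediateField.adjoin ℚ (Set.range y ∪ Set.range α))) := by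
  intro h
  obtain ⟨y, α, hα, hhyp, hnot⟩ :=
    royThesis_withoutLinearIndependent_fails (n := 1) le_rfl royAdmissible_example
  exact hnot (h 1 y α hα _ _ _ _ _ royAdmissible_example hhyp)

/-! ### `α_j ≠ 0` is load-bearing -/

/-- An auxiliary admissible tuple just inside Roy's example `(1.3, 0.7, 1.2, 0.5, 1.32)`: smaller
`t₁` (room for one extra factor `X₁`) and larger `u` (room for a factor `e · e^{N^{1.32}}`).
[cite: Roy2001, §1 (1)] -/
theorem royAdmissible_aux : RoyAdmissible 1.3 0.7 1.2 0.45 1.322 := by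
  refine ⟨by norm_num, by norm_num, by norm_num, by norm_num, by norm_num, ?_, ?_, by norm_num⟩ <;>
    norm_num

/-- **Witness for `α = 0`**: Roy's hypothesis holds for `(y, α) = (1, 0)` at Roy's example parameters
with `P_N = X₁ · R_N`, `R_N` the auxiliary polynomial of `exists_royAuxPoly` (tuple
`royAdmissible_aux`, radius `1`): the translate `m = 0` is `(0, 1) = (0, e^0)`, where
`|D^k(X₁R_N)(0,1)| ≤ k!·e·e^{−2N^{1.322}}` by Cauchy on `|z| = 1`; the translates `m ≥ 1` are
`(m, 0)`, where `X₁ ∣ D^k(X₁ R_N)` vanishes. [folklore] -/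
theorem royHypothesis_one_zero : RoyHypothesis (![1] : Fin 1 → ℂ) ![0] 1.3 0.7 1.2 0.5 1.32 := by
  have hA := royAdmissible_aux
  have h45 : (0.45 : ℝ) < 0.5 := by norm_num
  have h32 : (1.32 : ℝ) < 1.322 := by norm_num
  filter_upwards [exists_royAuxPoly hA le_rfl (c := 0), eventually_roy_params hA le_rfl (c := 0),
    eventually_nat_mul_rpow_le_rpow 2 h45, eventually_nat_mul_rpow_le_rpow 2 h32,
    eventually_ge_atTop 1] with N hR hpar g1 g2 hN
  have hN1 : (1 : ℝ) ≤ N := by exact_mod_cast hN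
  obtain ⟨R, hR0, hd0, hd1, hH, hval⟩ := hR
  obtain ⟨-, -, -, hfact⟩ := hpar
  refine ⟨X 1 * R, mul_ne_zero (X_ne_zero _) hR0, ?_, ?_, ?_, fun k m hk _ => ?_⟩
  · calc (((X 1 * R).degreeOf 0 : ℕ) : ℝ) ≤ ((R.degreeOf 0 : ℕ) : ℝ) := by
          exact_mod_cast (degreeOf_X_mul_le 0 1 R).trans (by simp)
      _ ≤ (N : ℝ) ^ (1.2 : ℝ) := hd0
  · calc (((X 1 * R).degreeOf 1 : ℕ) : ℝ) ≤ 1 + ((R.degreeOf 1 : ℕ) : ℝ) := by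
          exact_mod_cast (degreeOf_X_mul_le 1 1 R).trans (by simp)
      _ ≤ 1 + (N : ℝ) ^ (0.45 : ℝ) := by linarith
      _ ≤ 2 * (N : ℝ) ^ (0.45 : ℝ) := by
          have : (1 : ℝ) ≤ (N : ℝ) ^ (0.45 : ℝ) := Real.one_le_rpow hN1 (by norm_num)
          linarith
      _ ≤ (N : ℝ) ^ (0.5 : ℝ) := g1
  · calc ((mvPolyHeight (X 1 * R) : ℕ) : ℝ) ≤ ((mvPolyHeight R : ℕ) : ℝ) := by
          exact_mod_cast mvPolyHeight_X_mul_le 1 R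
      _ ≤ Real.exp N := hH
  · rw [point_one]
    rcases Nat.eq_zero_or_pos (m 0) with h0 | hpos
    · -- the translate `m = 0`: the point `(0, 1) = (0, e^0)` on the graph of `exp`
      rw [h0, pow_zero, Nat.cast_zero]
      have hsphere : ∀ z ∈ sphere (0 : ℂ) 1,
          ‖expEval (X 1 * R) z‖ ≤ Real.exp 1 * Real.exp (-(2 * (N : ℝ) ^ (1.322 : ℝ))) := by
        intro z hz
        have hz1 : ‖z‖ = 1 := by simpa using hz
        rw [expEval_apply, map_mul, norm_mul]
        refine mul_le_mul ?_ (hval z (by simp [hz1])) (norm_nonneg _) (Real.exp_pos _).le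
        have : aeval ![z, cexp z] (X 1 : MvPolynomial (Fin 2) ℤ) = cexp z := by simp
        rw [this, Complex.norm_exp]
        exact Real.exp_le_exp.2 ((Complex.re_le_norm z).trans hz1.le)
      have hC := norm_expEval_iterate_royD_le k (X 1 * R) 0 hsphere
      rw [expEval_apply, Complex.exp_zero] at hC
      calc ‖aeval ![(0 : ℂ), 1] (royD^[k] (X 1 * R))‖
          ≤ k.factorial * (Real.exp 1 * Real.exp (-(2 * (N : ℝ) ^ (1.322 : ℝ)))) := hC
        _ = Real.exp 1 * (k.factorial * Real.exp (-(2 * (N : ℝ) ^ (1.322 : ℝ)))) := by ring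
        _ ≤ Real.exp 1 * Real.exp (-(N : ℝ) ^ (1.322 : ℝ)) :=
            mul_le_mul_of_nonneg_left (hfact k hk) (Real.exp_pos _).le
        _ = Real.exp (1 - (N : ℝ) ^ (1.322 : ℝ)) := by rw [← Real.exp_add]; ring_nf
        _ ≤ Real.exp (-(N : ℝ) ^ (1.32 : ℝ)) := by
            refine Real.exp_le_exp.2 ?_
            have : (1 : ℝ) ≤ (N : ℝ) ^ (1.32 : ℝ) := Real.one_le_rpow hN1 (by norm_num)
            linarith
    · -- the translates `m ≥ 1`: the point `(m, 0)`, where `X₁ ∣ D^k (X₁ R)` vanishes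
      obtain ⟨Q, hQ⟩ := exists_iterate_royD_X_one_mul k R
      rw [zero_pow hpos.ne', hQ, map_mul]
      simp [(Real.exp_pos _).le]

/-- **`α_j ≠ 0` is load-bearing in `RoyThesis`**: the crux with `∀ j, α j ≠ 0` deleted (verbatim
otherwise) is FALSE — `(y, α) = (1, 0)`, Roy's example parameters, `P_N = X₁ R_N`.
[cite: Roy2001, Conjecture 2 (hypothesis α ∈ (ℂˣ)ˡ)] -/
theorem royThesis_false_without_units :
    ¬ (∀ (n : ℕ) (y α : Fin n → ℂ), LinearIndependent ℚ y →
      ∀ (s₀ s₁ t₀ t₁ u : ℝ), RoyAdmissible s₀ s₁ t₀ t₁ u → RoyHypothesis y α s₀ s₁ t₀ t₁ u →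
        (n : Cardinal) ≤ Algebra.trdeg ℚ ↥(IntermediateField.adjoin ℚ (Set.range y ∪ Set.range α))) :=
  fun h => not_one_le_trdeg_one isIntegral_zero
    (h 1 ![1] ![0] linearIndependent_one _ _ _ _ _ royAdmissible_example royHypothesis_one_zero)

/-! ### The window inequality `max(1, t₀, 2t₁) < min(s₀, 2s₁)` is load-bearing -/

/-- **Witness family at the integer point `(1, 1)`**: whenever `0 ≤ s₀ < min(1, t₀, t₁)` (so OUTSIDE
Roy's window, which has `2t₁ < s₀` and `1 < s₀`), Roy's hypothesis holds for `(y, α) = (1, 1)` with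
`P_N = (X₁ − 1)^{⌊N^{s₀}⌋+1}` and EXACT zeros `D^k P_N(m, 1) = 0`, `k ≤ N^{s₀}`, all `m`, for every
`s₁` and `u`. [folklore] -/
theorem royHypothesis_one_one {s₀ s₁ t₀ t₁ u : ℝ} (hs₀ : 0 ≤ s₀) (h0 : s₀ < t₀) (h1 : s₀ < t₁)
    (h2 : s₀ < 1) : RoyHypothesis (![1] : Fin 1 → ℂ) ![1] s₀ s₁ t₀ t₁ u := by
  filter_upwards [eventually_nat_mul_rpow_le_rpow 2 h0, eventually_nat_mul_rpow_le_rpow 2 h1,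
    eventually_nat_mul_rpow_le_rpow 2 h2, eventually_ge_atTop 1] with N e0 e1 e2 hN
  have hpow0 : (0 : ℝ) ≤ (N : ℝ) ^ s₀ := Real.rpow_nonneg (Nat.cast_nonneg N) _
  have hpow1 : (1 : ℝ) ≤ (N : ℝ) ^ s₀ := Real.one_le_rpow (by exact_mod_cast hN) hs₀
  set K : ℕ := ⌊(N : ℝ) ^ s₀⌋₊ with hK
  have hK2 : ((K + 1 : ℕ) : ℝ) ≤ 2 * (N : ℝ) ^ s₀ := by
    push_cast
    have : (K : ℝ) ≤ (N : ℝ) ^ s₀ := Nat.floor_le hpow0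
    linarith
  refine ⟨(X 1 - 1) ^ (K + 1), pow_ne_zero _ X_one_sub_one_ne_zero, ?_, ?_, ?_, fun k m hk _ => ?_⟩
  · calc (((X 1 - 1 : MvPolynomial (Fin 2) ℤ) ^ (K + 1)).degreeOf 0 : ℝ) ≤ ((K + 1 : ℕ) : ℝ) := by
          exact_mod_cast (degreeOf_le_totalDegree _ _).trans (totalDegree_pow_X_one_sub_one_le _)
      _ ≤ (N : ℝ) ^ t₀ := hK2.trans e0
  · calc (((X 1 - 1 : MvPolynomial (Fin 2) ℤ) ^ (K + 1)).degreeOf 1 : ℝ) ≤ ((K + 1 : ℕ) : ℝ) := by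
          exact_mod_cast (degreeOf_le_totalDegree _ _).trans (totalDegree_pow_X_one_sub_one_le _)
      _ ≤ (N : ℝ) ^ t₁ := hK2.trans e1
  · calc ((mvPolyHeight ((X 1 - 1 : MvPolynomial (Fin 2) ℤ) ^ (K + 1)) : ℕ) : ℝ)
          ≤ ((2 ^ (K + 1) : ℕ) : ℝ) := by exact_mod_cast mvPolyHeight_pow_X_one_sub_one_le _
      _ = (2 : ℝ) ^ (K + 1) := by push_cast; ring
      _ ≤ Real.exp 1 ^ (K + 1) := by
          refine pow_le_pow_left₀ (by norm_num) ?_ _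
          have := Real.add_one_le_exp (1 : ℝ); norm_num at this; linarith
      _ = Real.exp ((K + 1 : ℕ) : ℝ) := by rw [← Real.exp_one_pow]
      _ ≤ Real.exp N := Real.exp_le_exp.2 (hK2.trans (by simpa using e2))
  · have hk' : k < K + 1 := Nat.lt_succ_of_le (Nat.le_floor hk)
    rw [point_one, one_pow, aeval_iterate_royD_pow_eq_zero _ hk', norm_zero]
    exact (Real.exp_pos _).le

/-- **`max(1, t₀, 2t₁) < min(s₀, 2s₁)` is load-bearing in `RoyThesis`**: the crux with that window
inequality deleted — positivity of the parameters and both `u`-inequalities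
`max(s₀, s₁+t₁) < u < (1+t₀+t₁)/2` kept, verbatim otherwise — is FALSE: `(y, α) = (1, 1)`,
`(s₀, s₁, t₀, t₁, u) = (1/2, 1, 10, 1, 3)`, `P_N = (X₁ − 1)^{⌊√N⌋+1}`. [cite: Roy2001, §1 (1)] -/
theorem royThesis_false_without_window1 :
    ¬ (∀ (n : ℕ) (y α : Fin n → ℂ), LinearIndependent ℚ y → (∀ j, α j ≠ 0) →
      ∀ (s₀ s₁ t₀ t₁ u : ℝ), 0 < s₀ → 0 < s₁ → 0 < t₀ → 0 < t₁ → 0 < u →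
        max s₀ (s₁ + t₁) < u → u < (1 + t₀ + t₁) / 2 →
        RoyHypothesis y α s₀ s₁ t₀ t₁ u →
        (n : Cardinal) ≤ Algebra.trdeg ℚ ↥(IntermediateField.adjoin ℚ (Set.range y ∪ Set.range α))) :=
  fun h => not_one_le_trdeg_one isIntegral_one (h 1 ![1] ![1] linearIndependent_one (fun j => by simp)
    (1 / 2) 1 10 1 3 (by norm_num) (by norm_num) (by norm_num) (by norm_num) (by norm_num)
    (by norm_num) (by norm_num)
    (royHypothesis_one_one (by norm_num) (by norm_num) (by norm_num) (by norm_num)))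

/-- A fortiori the window `RoyAdmissible` cannot be dropped altogether. [cite: Roy2001, §1 (1)] -/
theorem royThesis_false_without_admissible :
    ¬ (∀ (n : ℕ) (y α : Fin n → ℂ), LinearIndependent ℚ y → (∀ j, α j ≠ 0) →
      ∀ (s₀ s₁ t₀ t₁ u : ℝ), RoyHypothesis y α s₀ s₁ t₀ t₁ u →
        (n : Cardinal) ≤ Algebra.trdeg ℚ ↥(IntermediateField.adjoin ℚ (Set.range y ∪ Set.range α))) :=
  fun h => royThesis_false_without_window1 fun n y α hy hα s₀ s₁ t₀ t₁ u _ _ _ _ _ _ _ hh =>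
    h n y α hy hα s₀ s₁ t₀ t₁ u hh

/-! ### Tightness of the conclusion -/

/-- **The exponent `n` of the conclusion cannot be improved to `n + 1`**: `(y, α) = (1, e)` is
linearly independent with units, satisfies Roy's hypothesis at every admissible tuple
(`royHypothesis_exp'`), and `trdeg ℚ(1, e) ≤ 1 < 2`. [folklore] -/
theorem royThesis_conclusion_sharp :
    ¬ (∀ (n : ℕ) (y α : Fin n → ℂ), LinearIndependent ℚ y → (∀ j, α j ≠ 0) →
      ∀ (s₀ s₁ t₀ t₁ u : ℝ), RoyAdmissible s₀ s₁ t₀ t₁ u → RoyHypothesis y α s₀ s₁ t₀ t₁ u →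
        ((n + 1 : ℕ) : Cardinal) ≤
          Algebra.trdeg ℚ ↥(IntermediateField.adjoin ℚ (Set.range y ∪ Set.range α))) := by
  intro h
  have hhyp := royHypothesis_exp' (![1] : Fin 1 → ℂ) royAdmissible_example
  have h2 := h 1 ![1] (cexp ∘ ![1]) linearIndependent_one (fun j => Complex.exp_ne_zero _)
    _ _ _ _ _ royAdmissible_example hhyp
  have hle : Algebra.trdeg ℚ ↥(IntermediateField.adjoin ℚ
      (Set.range (![1] : Fin 1 → ℂ) ∪ Set.range (cexp ∘ ![1]))) ≤ 1 := by
    refine trdeg_adjoin_le_one_of_subset (cexp 1) ?_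
    rintro x (⟨j, rfl⟩ | ⟨j, rfl⟩)
    · have : (![(1 : ℂ)] j) = 1 := by fin_cases j; rfl
      rw [this]; exact one_mem _
    · have : (cexp ∘ ![(1 : ℂ)]) j = cexp 1 := by fin_cases j; rfl
      rw [this]; exact IntermediateField.mem_adjoin_simple_self ℚ _
  have := h2.trans hle
  norm_num at this

end Summit.Schanuel.Schanuel.Theorems.RoyThesisNegative

end
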